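import Literature.NumberTheory.NumberFields.NarrowGenusRankInequality
import HarnessLib

/-!
# The narrow genus rank inequality, II: ONE-WITNESS certificates —
# `[Cl⁺(L):(Cl⁺(L))²] · 8 ∣ [Cl⁺(K):(Cl⁺(K))²]² · ∏_𝔭 e_𝔭` from one non-norm totally positive unit and one capitulating class

Topic `NumberTheory/NumberFields`; namespace `Literature.NumberTheory.NumberFields.AmbiguousClass`.  THEOREM-ONLY file (no definition, no named
fact, no instance, no `sorry`), written by the prover seat `bsd-2adic-k4-w2` GEN 13 (cell `bsd-2adic`; `--supports` stmt-BirchSwinnertonDyer-22617;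
closes nothing).  Sequel of `NarrowGenusRankInequality.lean` (the master divisibility
`[Cl⁺(L):(Cl⁺(L))²] · 2 · U⁺ · C ∣ h⁺(K) · [Cl⁺(K):(Cl⁺(K))²] · ∏ e_𝔭` for `L/K` Galois quadratic, `L` totally real, with
`U⁺ = [E_K⁺ : E_K⁺ ∩ N_G Lˣ]` and `C = #(capitulation kernel ∩ Cl⁺(K)[2])`).

WITNESSES (what a kernel certificate must exhibit).  `two_dvd_unitIndex_of_not_isNorm`: ONE totally positive unit `u` of `K` that is not a
relative norm (`∀ y, N_{L/K} y ≠ u`; in practice a dyadic Hilbert symbol `(u, m)_𝔭 = −1`) ⟹ `2 ∣ U⁺`.  `two_dvd_capitulationIndex_of_witness`: ONE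
`α ∈ Kˣ` of non-unit signature (`εα` is totally positive for no unit `ε` of `K`) which becomes narrowly principal in `L` (`wα ≫ 0` for some unit
`w` of `L`) ⟹ `2 ∣ C`.  COROLLARIES for `h(K)` odd: ★ `index_range_pow_two_narrowClassGroup_mul_eight_dvd` (both witnesses:
`[Cl⁺(L):(Cl⁺(L))²] · 8 ∣ [Cl⁺(K):(Cl⁺(K))²]² · ∏ e_𝔭`), `…_mul_four_dvd_of_unitIndex` (unit witness only), `…_mul_two_dvd` (no witness: the
trivial genus bound `ρ_L ≤ 2ρ_K + t − 1`).

READING for the cell's narrow census (a rung `(m, m+1)` of the cyclotomic `ℤ₂`-tower of a totally real cubic field with `ρ_m = rank₂ Cl⁺(K_m) = 1`,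
`h(K_m)` odd, two dyadic primes so `∏ e ∣ 4`): `[Cl⁺(K_{m+1}):(Cl⁺)²] · 8 ∣ 4 · 4`, i.e. `[Cl⁺(K_{m+1}):(Cl⁺)²] ∣ 2` — the EQUAL letter — from ONE
dyadic non-norm symbol downstairs and ONE unit upstairs with a prescribed (pulled-back) signature, instead of `[K_{m+1}:ℚ] − 1` sign-independent
units upstairs; the reverse divisibility `2 ∣ [Cl⁺(K_{m+1}):(Cl⁺)²]` is Fukuda / Edgar–Mollin–Peterson monotonicity (tree
`NarrowFukuda.index_range_pow_narrowClassGroup_dvd_succ`, `index_range_pow_two_narrowClassGroup_dvd_of_odd_classNumber`).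

References: [Gras2003] IV.4 (genus theory with signatures; the genus exact sequence); [FrohlichTaylor1990] Ch. V §1–§2; [Lang1990] Ch. 13 §4
Lemma 4.1; [EdgarMollinPeterson1986] Thm. 2.1.
-/

noncomputable section

open NumberField NumberField.InfinitePlace IsDedekindDomain FractionalIdeal
open scoped nonZeroDivisors Pointwise

namespace Literature.NumberTheory.NumberFields.AmbiguousClass

open Literature.NumberTheory.GaloisRepresentations Literature.NumberTheory.GaloisRepresentations.Herbrand
  Literature.NumberTheory.GaloisRepresentations.MinkowskiUnit
  Literature.NumberTheory.GaloisRepresentations.CyclicNormIndex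
  Literature.NumberTheory.NumberFields.AmbiguousIdeal

variable {K L : Type} [Field K] [NumberField K] [Field L] [NumberField L] [Algebra K L]

/-! ### §3 Witnesses and the certificate corollaries -/

/-- **ONE totally positive unit of `K` that is not a relative norm makes the unit index even**: if `u ∈ E_K⁺` and `N_{L/K} y ≠ u` for every
`y ∈ L`, then `2 ∣ U⁺ = [E_K⁺ : E_K⁺ ∩ N_G Lˣ]` (the class of `u` has order `2`: `u² = N_G u`). [cite: Lang1990, Ch. 13 §4, Lemma 4.1 (unit index)]
[cite: Gras2003, II.6.2.3] -/
theorem two_dvd_unitIndex_of_not_isNorm [IsGalois K L] [IsTotallyReal L] {σ : L ≃ₐ[K] L}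
    (hσ : ∀ τ : L ≃ₐ[K] L, τ ∈ Subgroup.zpowers σ) (h2 : Module.finrank K L = 2)
    (u : (𝓞 K)ˣ) (hpos : ∀ ρ : K →+* ℝ, 0 < ρ ((u : 𝓞 K) : K)) (hN : ∀ y : L, Algebra.norm K y ≠ ((u : 𝓞 K) : K)) :
    2 ∣ ((unitsE L ⊓ (signHom L).ker) ⊓ (⊤ : Subgroup Lˣ).map (Herbrand.norm (L ≃ₐ[K] L))).relIndex
          ((unitsE L ⊓ (signHom L).ker) ⊓ (unitsIncl K L).range) := by
  classical
  haveI : FiniteDimensional K L := Module.Finite.of_restrictScalars_finite ℚ K L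
  set H₁ : Subgroup Lˣ := (unitsE L ⊓ (signHom L).ker) ⊓ (⊤ : Subgroup Lˣ).map (Herbrand.norm (L ≃ₐ[K] L)) with hH₁
  set H₂ : Subgroup Lˣ := (unitsE L ⊓ (signHom L).ker) ⊓ (unitsIncl K L).range with hH₂
  set x : Lˣ := unitsIncl K L (Units.map (algebraMap (𝓞 K) K : 𝓞 K →* K) u) with hx
  -- `x ∈ H₂`
  have hxE : x ∈ unitsE L ⊓ (unitsIncl K L).range := by
    rw [← range_unitsIncl_comp_unitsMap_eq]; exact ⟨u, rfl⟩
  have hxpos : x ∈ (signHom L).ker := by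
    rw [mem_ker_signHom_iff]
    intro ψ
    rw [hx, coe_unitsIncl, ← RingHom.comp_apply]
    exact hpos _
  have hx₂ : x ∈ H₂ := ⟨⟨hxE.1, hxpos⟩, hxE.2⟩
  -- `x ∉ H₁`
  have hx₁ : x ∉ H₁ := by
    rintro ⟨-, ⟨y, -, hy⟩⟩
    apply hN (y : L)
    apply (algebraMap K L).injective
    rw [Algebra.norm_eq_prod_automorphisms]
    have hval : (((Herbrand.norm (L ≃ₐ[K] L) y : Lˣ)) : L) = ∏ g : L ≃ₐ[K] L, g (y : L) := by
      rw [Herbrand.norm_apply, Units.coe_prod]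
      rfl
    rw [← hval, hy, hx, coe_unitsIncl]
    rfl
  -- `x² ∈ H₁`
  have hx2 : x ^ 2 ∈ H₁ := by
    refine ⟨⟨(unitsE L).pow_mem hxE.1 2, ((signHom L).ker).pow_mem hxpos 2⟩, ⟨x, Subgroup.mem_top x, ?_⟩⟩
    rw [norm_eq_mul_smul_of_finrank_eq_two hσ h2, hx, smul_unitsIncl, pow_two]
  -- the class of `x` in `H₂/(H₁ ∩ H₂)` has order `2`
  set q : H₂ ⧸ H₁.subgroupOf H₂ := QuotientGroup.mk ⟨x, hx₂⟩ with hq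
  have hq1 : q ≠ 1 := by
    intro h
    rw [hq, QuotientGroup.eq_one_iff, Subgroup.mem_subgroupOf] at h
    exact hx₁ h
  have hq2 : q ^ 2 = 1 := by
    rw [hq, ← QuotientGroup.mk_pow, QuotientGroup.eq_one_iff, Subgroup.mem_subgroupOf]
    exact hx2
  have hord : orderOf q = 2 := by
    have hdvd : orderOf q ∣ 2 := orderOf_dvd_of_pow_eq_one hq2
    rcases (Nat.dvd_prime Nat.prime_two).mp hdvd with h1 | h2'
    · exact absurd (orderOf_eq_one_iff.mp h1) hq1
    · exact h2'
  change 2 ∣ (H₁.subgroupOf H₂).index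
  rw [Subgroup.index_eq_card, ← hord]
  exact orderOf_dvd_natCard q

/-- **ONE non-trivial narrow class of `K` killed by `2` that capitulates in `L` makes `C` even**: `α ∈ Kˣ` such that `εα` is totally positive for
NO unit `ε` of `K` (the narrow class of `(α)` is non-trivial; it is killed by `2` since `(α)² = (α²)`), but `wα` is totally positive in `L` for SOME
unit `w` of `L` (`(α)𝓞_L` is narrowly principal) ⟹ `2 ∣ C = [Cap ∩ S_K : P_K⁺]`. [cite: Gras2003, IV.4 (capitulation in the genus exact sequence)]
[cite: FrohlichTaylor1990, Ch. V §1 (P_N⁺), p. 163] -/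
theorem two_dvd_capitulationIndex_of_witness [IsTotallyReal L] (α : Kˣ)
    (hK : ∀ ε : (𝓞 K)ˣ, ¬ ∀ ρ : K →+* ℝ, 0 < ρ (((ε : 𝓞 K) : K) * α))
    (hL : ∃ w : (𝓞 L)ˣ, ∀ τ : L →+* ℝ, 0 < τ (((w : 𝓞 L) : L) * algebraMap K L α)) :
    2 ∣ (totPosPrincipalIdeals K).relIndex
          ((totPosPrincipalIdeals L).comap (Units.map (extendedHom L (𝓞 L) :
              FractionalIdeal (𝓞 K)⁰ K →+* FractionalIdeal (𝓞 L)⁰ L).toMonoidHom) ⊓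
            (totPosPrincipalIdeals K).comap (powMonoidHom (α := (FractionalIdeal (𝓞 K)⁰ K)ˣ) 2)) := by
  classical
  set P : Subgroup (FractionalIdeal (𝓞 L)⁰ L)ˣ := totPosPrincipalIdeals L with hP
  set PK : Subgroup (FractionalIdeal (𝓞 K)⁰ K)ˣ := totPosPrincipalIdeals K with hPK
  set ι := (Units.map (extendedHom L (𝓞 L) :
      FractionalIdeal (𝓞 K)⁰ K →+* FractionalIdeal (𝓞 L)⁰ L).toMonoidHom) with hι
  set S : Subgroup (FractionalIdeal (𝓞 K)⁰ K)ˣ := PK.comap (powMonoidHom (α := (FractionalIdeal (𝓞 K)⁰ K)ˣ) 2) with hS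
  set Cap : Subgroup (FractionalIdeal (𝓞 K)⁰ K)ˣ := P.comap ι with hCap
  set J : (FractionalIdeal (𝓞 K)⁰ K)ˣ := toPrincipalIdeal (𝓞 K) K α with hJ
  -- `J ∈ S`: `(α)² = (α²)` with `α² ≫ 0`
  have hJS : J ∈ S := by
    change J ^ 2 ∈ PK
    rw [hJ, ← map_pow]
    refine ⟨α ^ 2, ?_, rfl⟩
    rw [SetLike.mem_coe, mem_ker_signHom_iff]
    intro ρ
    rw [Units.val_pow_eq_pow_val, map_pow]
    exact pow_two_pos_of_ne_zero (embedding_units_ne_zero K ρ α)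
  -- `J ∈ Cap`: `ι(α) = (α)_L = (wα)_L` with `wα ≫ 0`
  have hJCap : J ∈ Cap := by
    obtain ⟨w, hw⟩ := hL
    set w' : Lˣ := Units.map (algebraMap (𝓞 L) L : 𝓞 L →* L) w with hw'
    have hw'ker : w' ∈ (toPrincipalIdeal (𝓞 L) L).ker := by
      rw [ker_toPrincipalIdeal_eq_unitsE]; exact ⟨w, rfl⟩
    change ι J ∈ P
    rw [hJ, hι, unitsMap_extendedHom_toPrincipalIdeal]
    refine ⟨w' * unitsIncl K L α, ?_, ?_⟩
    · rw [SetLike.mem_coe, mem_ker_signHom_iff]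
      intro τ
      rw [Units.val_mul, hw', coe_unitsIncl]
      exact hw τ
    · rw [map_mul, (MonoidHom.mem_ker).mp hw'ker, one_mul]
  -- `J ∉ P_K⁺`
  have hJPK : J ∉ PK := by
    rintro ⟨β, hβ, hβJ⟩
    have hker : α * β⁻¹ ∈ (toPrincipalIdeal (𝓞 K) K).ker := by
      rw [MonoidHom.mem_ker, map_mul, map_inv, ← hJ, ← hβJ, mul_inv_cancel]
    rw [ker_toPrincipalIdeal_eq_unitsE, mem_unitsE_iff] at hker
    obtain ⟨ε₀, hε₀⟩ := hker
    apply hK ε₀⁻¹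
    intro ρ
    have hβpos := (mem_ker_signHom_iff K).mp hβ ρ
    have hαβ : (((ε₀⁻¹ : (𝓞 K)ˣ) : 𝓞 K) : K) * (α : K) = (β : K) := by
      have h1 : ((Units.map (algebraMap (𝓞 K) K : 𝓞 K →* K) ε₀ : Kˣ) : K) = (α : K) * ((β⁻¹ : Kˣ) : K) := by
        rw [hε₀, Units.val_mul]
      have h2 : (((ε₀⁻¹ : (𝓞 K)ˣ) : 𝓞 K) : K) * (((ε₀ : (𝓞 K)ˣ) : 𝓞 K) : K) = 1 := by
        rw [← map_mul, Units.inv_mul, map_one]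
      have h3 : ((Units.map (algebraMap (𝓞 K) K : 𝓞 K →* K) ε₀ : Kˣ) : K) = (((ε₀ : (𝓞 K)ˣ) : 𝓞 K) : K) := rfl
      rw [h3] at h1
      calc (((ε₀⁻¹ : (𝓞 K)ˣ) : 𝓞 K) : K) * (α : K)
          = (((ε₀⁻¹ : (𝓞 K)ˣ) : 𝓞 K) : K) * ((((ε₀ : (𝓞 K)ˣ) : 𝓞 K) : K) * (β : K)) := by
            rw [h1, mul_assoc, Units.val_inv_eq_inv_val, inv_mul_cancel₀ β.ne_zero, mul_one]
        _ = (β : K) := by rw [← mul_assoc, h2, one_mul]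
    rw [hαβ]
    exact hβpos
  -- the class of `J` in `(Cap ∩ S)/P_K⁺` has order `2`
  have hPK_le : PK ≤ Cap ⊓ S := by
    intro I hI
    refine ⟨?_, ?_⟩
    · change ι I ∈ P
      obtain ⟨b, hb, rfl⟩ := hI
      rw [hι, unitsMap_extendedHom_toPrincipalIdeal]
      exact ⟨unitsIncl K L b, map_unitsIncl_ker_signHom_le ⟨b, hb, rfl⟩, rfl⟩
    · change I ^ 2 ∈ PK
      exact PK.pow_mem hI 2
  set q : ↥(Cap ⊓ S) ⧸ PK.subgroupOf (Cap ⊓ S) := QuotientGroup.mk ⟨J, ⟨hJCap, hJS⟩⟩ with hq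
  have hq1 : q ≠ 1 := by
    intro h
    rw [hq, QuotientGroup.eq_one_iff, Subgroup.mem_subgroupOf] at h
    exact hJPK h
  have hq2 : q ^ 2 = 1 := by
    rw [hq, ← QuotientGroup.mk_pow, QuotientGroup.eq_one_iff, Subgroup.mem_subgroupOf]
    exact hJS
  have hord : orderOf q = 2 := by
    have hdvd : orderOf q ∣ 2 := orderOf_dvd_of_pow_eq_one hq2
    rcases (Nat.dvd_prime Nat.prime_two).mp hdvd with h1 | h2'
    · exact absurd (orderOf_eq_one_iff.mp h1) hq1
    · exact h2'
  change 2 ∣ (PK.subgroupOf (Cap ⊓ S)).index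
  rw [Subgroup.index_eq_card, ← hord]
  exact orderOf_dvd_natCard q

/-- `2`-adic bookkeeping: a power of `2` dividing `h · M` with `h` odd divides `M`. [folklore] -/
private theorem pow_two_dvd_of_dvd_odd_mul {k h M : ℕ} (hh : Odd h) (hd : 2 ^ k ∣ h * M) : 2 ^ k ∣ M :=
  (Nat.Coprime.pow_left k (Nat.coprime_two_left.mpr hh)).dvd_of_dvd_mul_left hd

/-- ★ **The narrow-rank EQUAL certificate by genus theory**: `L/K` Galois quadratic, `L` totally real, `h(K)` odd, ONE totally positive unit of
`K` that is not a relative norm (`2 ∣ U⁺`) and ONE non-trivial `2`-torsion narrow class of `K` capitulating in `L` (`2 ∣ C`) ⟹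
**`[Cl⁺(L):(Cl⁺(L))²] · 8 ∣ [Cl⁺(K):(Cl⁺(K))²]² · ∏_𝔭 e_𝔭`**.  With `[Cl⁺(K):(Cl⁺(K))²] = 2` and `∏ e_𝔭 ∣ 4` (two ramified primes):
`[Cl⁺(L):(Cl⁺(L))²] ∣ 2` — EQUAL narrow `2`-rank `1` (the reverse divisibility is Edgar–Mollin–Peterson / Fukuda monotonicity).
[cite: Gras2003, IV.4] [cite: FrohlichTaylor1990, Ch. V §2] [cite: EdgarMollinPeterson1986, Thm. 2.1] -/
theorem index_range_pow_two_narrowClassGroup_mul_eight_dvd [IsGalois K L] [IsTotallyReal L] {σ : L ≃ₐ[K] L}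
    (hσ : ∀ τ : L ≃ₐ[K] L, τ ∈ Subgroup.zpowers σ) (h2 : Module.finrank K L = 2) (hK : Odd (classNumber K))
    (hU : 2 ∣ ((unitsE L ⊓ (signHom L).ker) ⊓ (⊤ : Subgroup Lˣ).map (Herbrand.norm (L ≃ₐ[K] L))).relIndex
          ((unitsE L ⊓ (signHom L).ker) ⊓ (unitsIncl K L).range))
    (hC : 2 ∣ (totPosPrincipalIdeals K).relIndex
          ((totPosPrincipalIdeals L).comap (Units.map (extendedHom L (𝓞 L) :
              FractionalIdeal (𝓞 K)⁰ K →+* FractionalIdeal (𝓞 L)⁰ L).toMonoidHom) ⊓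
            (totPosPrincipalIdeals K).comap (powMonoidHom (α := (FractionalIdeal (𝓞 K)⁰ K)ˣ) 2))) :
    (powMonoidHom (α := NarrowClassGroup L) 2).range.index * 8 ∣
      (powMonoidHom (α := NarrowClassGroup K) 2).range.index ^ 2 *
        ∏ᶠ v : HeightOneSpectrum (𝓞 K), v.asIdeal.ramificationIdxIn (𝓞 L) := by
  haveI : Fact (Nat.Prime 2) := ⟨Nat.prime_two⟩
  have h := index_range_pow_two_narrowClassGroup_mul_dvd_of_odd_classNumber hσ h2 hK
  obtain ⟨a, ha⟩ := hU
  obtain ⟨b, hb⟩ := hC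
  obtain ⟨k, hk⟩ := index_range_powMonoidHom_narrowClassGroup_eq_prime_pow (K := L) 2
  rw [ha, hb, hk] at h
  rw [hk]
  have h' : 2 ^ (k + 3) ∣ 2 ^ k * 2 * (2 * a) * (2 * b) := ⟨a * b, by ring⟩
  have h8 := h'.trans h
  rw [mul_assoc (classNumber K)] at h8
  rw [show 2 ^ k * 8 = 2 ^ (k + 3) by ring]
  exact pow_two_dvd_of_dvd_odd_mul hK h8

/-- **One witness only (unit index)**: `h(K)` odd and `2 ∣ U⁺` ⟹ `[Cl⁺(L):(Cl⁺(L))²] · 4 ∣ [Cl⁺(K):(Cl⁺(K))²]² · ∏_𝔭 e_𝔭`.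
[cite: Gras2003, IV.4] [cite: FrohlichTaylor1990, Ch. V §2] -/
theorem index_range_pow_two_narrowClassGroup_mul_four_dvd_of_unitIndex [IsGalois K L] [IsTotallyReal L] {σ : L ≃ₐ[K] L}
    (hσ : ∀ τ : L ≃ₐ[K] L, τ ∈ Subgroup.zpowers σ) (h2 : Module.finrank K L = 2) (hK : Odd (classNumber K))
    (hU : 2 ∣ ((unitsE L ⊓ (signHom L).ker) ⊓ (⊤ : Subgroup Lˣ).map (Herbrand.norm (L ≃ₐ[K] L))).relIndex
          ((unitsE L ⊓ (signHom L).ker) ⊓ (unitsIncl K L).range)) :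
    (powMonoidHom (α := NarrowClassGroup L) 2).range.index * 4 ∣
      (powMonoidHom (α := NarrowClassGroup K) 2).range.index ^ 2 *
        ∏ᶠ v : HeightOneSpectrum (𝓞 K), v.asIdeal.ramificationIdxIn (𝓞 L) := by
  haveI : Fact (Nat.Prime 2) := ⟨Nat.prime_two⟩
  have h := index_range_pow_two_narrowClassGroup_mul_dvd_of_odd_classNumber hσ h2 hK
  obtain ⟨a, ha⟩ := hU
  obtain ⟨k, hk⟩ := index_range_powMonoidHom_narrowClassGroup_eq_prime_pow (K := L) 2
  set C := (totPosPrincipalIdeals K).relIndex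
          ((totPosPrincipalIdeals L).comap (Units.map (extendedHom L (𝓞 L) :
              FractionalIdeal (𝓞 K)⁰ K →+* FractionalIdeal (𝓞 L)⁰ L).toMonoidHom) ⊓
            (totPosPrincipalIdeals K).comap (powMonoidHom (α := (FractionalIdeal (𝓞 K)⁰ K)ˣ) 2)) with hCdef
  -- `C ≠ 0`: it divides a non-zero number through the master divisibility?  Simpler: `P_K⁺ ≤ Cap ∩ S_K ≤ S_K` and `[S_K : P_K⁺] ≠ 0`.
  have hC0 : C ≠ 0 := by
    have hle : (totPosPrincipalIdeals L).comap (Units.map (extendedHom L (𝓞 L) :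
              FractionalIdeal (𝓞 K)⁰ K →+* FractionalIdeal (𝓞 L)⁰ L).toMonoidHom) ⊓
            (totPosPrincipalIdeals K).comap (powMonoidHom (α := (FractionalIdeal (𝓞 K)⁰ K)ˣ) 2) ≤
        (totPosPrincipalIdeals K).comap (powMonoidHom (α := (FractionalIdeal (𝓞 K)⁰ K)ˣ) 2) := inf_le_right
    have hne : (totPosPrincipalIdeals K).relIndex
        ((totPosPrincipalIdeals K).comap (powMonoidHom (α := (FractionalIdeal (𝓞 K)⁰ K)ˣ) 2)) ≠ 0 := by
      rw [relIndex_totPosPrincipalIdeals_sqComap_eq]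
      haveI : Finite (NarrowClassGroup K) := finite_rayClassGroup top_ne_bot
      exact Subgroup.index_ne_zero_of_finite
    intro h0
    exact hne (Subgroup.relIndex_eq_zero_of_le_right hle (hCdef ▸ h0))
  obtain ⟨c, hc⟩ : ∃ c, C = c + 1 := Nat.exists_eq_succ_of_ne_zero hC0
  rw [ha, hk, hc] at h
  rw [hk]
  have h' : 2 ^ (k + 2) ∣ 2 ^ k * 2 * (2 * a) * (c + 1) := ⟨a * (c + 1), by ring⟩
  have h4 := h'.trans h
  rw [mul_assoc (classNumber K)] at h4
  rw [show 2 ^ k * 4 = 2 ^ (k + 2) by ring]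
  exact pow_two_dvd_of_dvd_odd_mul hK h4

/-- **No witness** (`h(K)` odd): `[Cl⁺(L):(Cl⁺(L))²] · 2 ∣ [Cl⁺(K):(Cl⁺(K))²]² · ∏_𝔭 e_𝔭`, i.e. `ρ_L ≤ 2ρ_K + t − 1` — the trivial genus
bound (for `ρ_K = 0` it is the `≤` half of `rank₂ Cl⁺(L) = t − 1`, tree `index_range_pow_two_narrowClassGroup_mul_two_eq`).
[cite: Gras2003, IV.4] [cite: FrohlichTaylor1990, Ch. V §2] -/
theorem index_range_pow_two_narrowClassGroup_mul_two_dvd [IsGalois K L] [IsTotallyReal L] {σ : L ≃ₐ[K] L}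
    (hσ : ∀ τ : L ≃ₐ[K] L, τ ∈ Subgroup.zpowers σ) (h2 : Module.finrank K L = 2) (hK : Odd (classNumber K)) :
    (powMonoidHom (α := NarrowClassGroup L) 2).range.index * 2 ∣
      (powMonoidHom (α := NarrowClassGroup K) 2).range.index ^ 2 *
        ∏ᶠ v : HeightOneSpectrum (𝓞 K), v.asIdeal.ramificationIdxIn (𝓞 L) := by
  haveI : Fact (Nat.Prime 2) := ⟨Nat.prime_two⟩
  haveI : IsUnramifiedAtInfinitePlaces K L := isUnramifiedAtInfinitePlaces_of_isTotallyReal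
  have h := index_range_pow_two_narrowClassGroup_mul_dvd_of_odd_classNumber hσ h2 hK
  obtain ⟨k, hk⟩ := index_range_powMonoidHom_narrowClassGroup_eq_prime_pow (K := L) 2
  set U := ((unitsE L ⊓ (signHom L).ker) ⊓ (⊤ : Subgroup Lˣ).map (Herbrand.norm (L ≃ₐ[K] L))).relIndex
      ((unitsE L ⊓ (signHom L).ker) ⊓ (unitsIncl K L).range) with hUdef
  set C := (totPosPrincipalIdeals K).relIndex
          ((totPosPrincipalIdeals L).comap (Units.map (extendedHom L (𝓞 L) :
              FractionalIdeal (𝓞 K)⁰ K →+* FractionalIdeal (𝓞 L)⁰ L).toMonoidHom) ⊓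
            (totPosPrincipalIdeals K).comap (powMonoidHom (α := (FractionalIdeal (𝓞 K)⁰ K)ˣ) 2)) with hCdef
  have hU0 : U ≠ 0 := by
    rw [hUdef, ← unitsPos_inf_map_norm_ker_signHom_eq hσ]
    exact (relIndex_unitsPosNorm_ne_zero hσ).1
  have hC0 : C ≠ 0 := by
    have hle : (totPosPrincipalIdeals L).comap (Units.map (extendedHom L (𝓞 L) :
              FractionalIdeal (𝓞 K)⁰ K →+* FractionalIdeal (𝓞 L)⁰ L).toMonoidHom) ⊓
            (totPosPrincipalIdeals K).comap (powMonoidHom (α := (FractionalIdeal (𝓞 K)⁰ K)ˣ) 2) ≤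
        (totPosPrincipalIdeals K).comap (powMonoidHom (α := (FractionalIdeal (𝓞 K)⁰ K)ˣ) 2) := inf_le_right
    have hne : (totPosPrincipalIdeals K).relIndex
        ((totPosPrincipalIdeals K).comap (powMonoidHom (α := (FractionalIdeal (𝓞 K)⁰ K)ˣ) 2)) ≠ 0 := by
      rw [relIndex_totPosPrincipalIdeals_sqComap_eq]
      haveI : Finite (NarrowClassGroup K) := finite_rayClassGroup top_ne_bot
      exact Subgroup.index_ne_zero_of_finite
    intro h0
    exact hne (Subgroup.relIndex_eq_zero_of_le_right hle (hCdef ▸ h0))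
  obtain ⟨a, ha⟩ : ∃ a, U = a + 1 := Nat.exists_eq_succ_of_ne_zero hU0
  obtain ⟨c, hc⟩ : ∃ c, C = c + 1 := Nat.exists_eq_succ_of_ne_zero hC0
  rw [ha, hc, hk] at h
  rw [hk]
  have h' : 2 ^ (k + 1) ∣ 2 ^ k * 2 * (a + 1) * (c + 1) := ⟨(a + 1) * (c + 1), by ring⟩
  have h2' := h'.trans h
  rw [mul_assoc (classNumber K)] at h2'
  rw [show 2 ^ k * 2 = 2 ^ (k + 1) by ring]
  exact pow_two_dvd_of_dvd_odd_mul hK h2'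

end Literature.NumberTheory.NumberFields.AmbiguousClass

end
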